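import Literature.MathematicalPhysics.QuantumFieldTheory.WilsonFinTorusTwistTensor
import Literature.MathematicalPhysics.QuantumFieldTheory.YangMillsOS
import HarnessLib

/-!
# The e-flux-projected, magnetically twisted slab: vocabulary of census row 43 (`twisted-slab-continuity`)

Route-posited objects (a `…Defs` file, D-0016) for the crux `IRcof` (stmt-QuantumFields-26930), LINE
`twisted-slab-continuity` (ideator ym-ir-idea-20 g0, lens `resurrect`; critic of record ym-ir-crit-3 g3: PASS-WITH-PRICE;
census `pub/ym-ir/REDUCTION-CENSUS.md` §L row 43), typed here VERBATIM from the crux workfile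
`Summits/QuantumFields/YangMills/Cruxes/IRcof/Lines/twisted_slab_continuity.lean` §1–§2 so that prover-written helper files
(`BalabanLadderIRTwistedSlab*.lean`, LEAD prover ym-ir-line-tsc-p1) can speak about the SAME constants by name; the workfile's
copies are definitionally equal to these.

Contents (definitions only; every body is the workfile's, byte for byte, except that the two twist maps `slabMagTwist`,
`slabElecTwist` — the magnetic and electric halves of `slabTwist`, used to read the e-flux projection as one of 't Hooft's
flux sectors `Literature.MathematicalPhysics.QuantumFieldTheory.wilsonFinTorusMagneticFluxPartition` — are new plumbing):

* `slabTwist zM zE` — the slab twist tensor: magnetic twist `zM` on the transverse plane `(0,1)`, electric twist `zE` on the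
  plane `(2,3)` ('t Hooft's `n_{01} = m`, `n_{23} = k`);
* `slabMagTwist z`, `slabElecTwist z n k` — its two halves (`slabTwist z (z^k) = elecMagTwistTensor (slabElecTwist z n k)
  (slabMagTwist z)`, proved in `BalabanLadderIRTwistedSlabOneBox`);
* `projSlabZ ρ β z n ℓ L t := n⁻¹ Σ_{k<n} W{slabTwist z z^k}(ℓ,ℓ,L,t)` — the e₂-flux-projected twisted slab partition function
  ('t Hooft 1979 (5.2)–(5.4) at `e = 0`, magnetic flux `z` through the transverse torus);
* `projSlabDefect ρ β z n ℓ L t := 1 − projSlabZ(2t) / projSlabZ(t)²` — its period-doubling purity defect;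
* `HasIsolatingTwist G z` — pure group theory: `z` is a commutator, all pairs with commutator `z` are simultaneously conjugate,
  and their simultaneous centraliser is finite ('t Hooft's twist-eating pair is unique and rigid: `SU(N)` with `z` a generator
  of `Z_N`);
* `TwistedSlabAnchor` — the line's stub **T1** (the located femto ANCHOR): for simply-connected compact simple `G`, a central
  `z ≠ 1` of finite order with an isolating twist and every lattice representation, the projected twisted femto slab
  `ℓ₀ × ℓ₀ × L × t` is pure, `projSlabDefect ≤ C·L·e^{−ct}`, UNIFORMLY in `β ≥ β₀`, `L ≥ 2`, `t ≥ 1`.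

HONEST FRAMING: definitions; nothing is claimed.  `TwistedSlabAnchor` is an OPEN obligation (its content is a β- and
L-uniform weak-coupling cluster expansion about the isolated twist-eating vacuum of the twisted femto tube; no theorem in print
covers it); the one-box, box-dependent version is proved in `BalabanLadderIRTwistedSlabOneBox`.  Nothing here bears on
`IRcof` (0∕1), `IR`, or the Yang–Mills mass gap (Clay: NOT proved); R4 closes only the conditional finite-𝕋⁴ rung `BalabanLadder.UV`.

References: G. 't Hooft, Nucl. Phys. B 153 (1979) 141, §§2–5; A. González-Arroyo, M. Okawa, Phys. Rev. D 27 (1983) 2397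
(twist eaters); P. van Baal, Commun. Math. Phys. 85 (1982) 529.
-/

set_option autoImplicit false

noncomputable section

open scoped BigOperators
open Literature.MathematicalPhysics.QuantumFieldTheory

namespace Summit.QuantumFields.YangMills.Cruxes.IRcof.TwistedSlab

/-! ## §1 Currency: the e-flux-projected, magnetically twisted slab -/

section Defs

variable {G : Type*} [Group G]

/-- The slab twist tensor: magnetic twist `zM` on the plane `(0,1)` (the two transverse directions of size `ℓ`), electric twist `zE`
on the plane `(2,3)` (long direction `2` against Euclidean time `3`), no other twist ('t Hooft's `n_{01} = m₂`, `n_{23} = k₂`).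
VERBATIM the crux workfile's `TwistedSlabContinuity.slabTwist`. [cite: tHooft1979Flux, §2 (2.5)] -/
def slabTwist (zM zE : G) : Fin 4 → Fin 4 → G :=
  fun μ ν => if μ = 0 ∧ ν = 1 then zM else if μ = 2 ∧ ν = 3 then zE else 1

/-- The magnetic half of the slab twist: `z` on the transverse plane `(0,1)`, nothing else (the tensor `slabTwist z 1`).
[cite: tHooft1979Flux, §2 (2.5)] -/
def slabMagTwist (z : G) : Fin 4 → Fin 4 → G :=
  fun μ ν => if μ = 0 ∧ ν = 1 then z else 1

/-- The electric half of the slab twist, as a FAMILY over `ℤ_n`: the temporal twist vector with `z ^ k` in the long direction `2`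
and `1` elsewhere — 't Hooft's `Ω[k]`, `k = (0, 0, k)`, whose average over `k` projects onto electric flux `e₂ = 0`.
[cite: tHooft1979Flux, §4 (4.2) and §5 (5.2)] -/
def slabElecTwist (z : G) (n : ℕ) (k : ZMod n) : Fin 4 → G :=
  fun μ => if μ = 2 then z ^ (k.val) else 1

variable [TopologicalSpace G] [IsTopologicalGroup G] [CompactSpace G] [MeasurableSpace G] [BorelSpace G]

/-- **The projected twisted slab partition function** `Z^{proj}_{β}(ℓ, ℓ, L; t) := n⁻¹ Σ_{k<n} W{n_{01} = z, n_{23} = z^k}(ℓ,ℓ,L,t)`: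
the Wilson box `ℓ × ℓ × L × t` with 't Hooft's magnetic twist `z` through the transverse 2-torus, traced in the sector of ZERO electric
flux along the long direction `2` ('t Hooft 1979 (5.2)–(5.4): averaging the temporal twists `z^k`, `k < n`, `z^n = 1`, projects onto
`e₂ = 0`).  Real, a finite average of `wilsonFinTorusTensorTwistedPartition`s.  VERBATIM the crux workfile's `TwistedSlabContinuity.projSlabZ`.
[cite: tHooft1979Flux, §5 (5.2)–(5.4)] -/
def projSlabZ {N : ℕ} (ρ : G →* Matrix (Fin N) (Fin N) ℂ) (β : ℝ) (z : G) (n : ℕ) (ℓ L t : ℕ) : ℝ :=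
  (n : ℝ)⁻¹ * ∑ k : Fin n, wilsonFinTorusTensorTwistedPartition ρ β (slabTwist z (z ^ (k : ℕ))) ℓ ℓ L t

/-- **The projected twisted slab purity defect** along Euclidean time at period `t ↦ 2t`:
`1 − Z^{proj}(ℓ,ℓ,L;2t) / Z^{proj}(ℓ,ℓ,L;t)²` (`= 1 − tr ϱ²` for the normalised `e₂ = 0`-projected thermal state of the twisted slice).
VERBATIM the crux workfile's `TwistedSlabContinuity.projSlabDefect`. [cite: tHooft1979Flux, §5 (5.1)–(5.4)] -/
def projSlabDefect {N : ℕ} (ρ : G →* Matrix (Fin N) (Fin N) ℂ) (β : ℝ) (z : G) (n : ℕ) (ℓ L t : ℕ) : ℝ :=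
  1 - projSlabZ ρ β z n ℓ L (2 * t) / projSlabZ ρ β z n ℓ L t ^ 2

end Defs

/-! ## §2 The isolating twist and the anchor obligation T1 -/

/-- **Isolating twist** (pure group theory): `z` is the commutator of SOME pair, all pairs with commutator `z` form ONE simultaneous
conjugation orbit, and the simultaneous centraliser of such a pair is finite — 't Hooft's twist-eating pair is unique modulo gauge and
leaves no flat direction (`SU(N)` with `z` a generator of `Z_N`: clock and shift; fails for non-generating `z` and for the types
`B, C, D, E₆, E₇`, where almost-commuting pairs have moduli; centre-free `G₂, F₄, E₈` have no `z ≠ 1` at all).  VERBATIM the crux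
workfile's `TwistedSlabContinuity.HasIsolatingTwist`; a predicate (group theory), source: 't Hooft 1979 §3, González-Arroyo–Okawa 1983. -/
def HasIsolatingTwist (G : Type) [Group G] (z : G) : Prop :=
  (∃ A B : G, A * B * A⁻¹ * B⁻¹ = z) ∧
  (∀ A B A' B' : G, A * B * A⁻¹ * B⁻¹ = z → A' * B' * A'⁻¹ * B'⁻¹ = z →
      ∃ g : G, A' = g * A * g⁻¹ ∧ B' = g * B * g⁻¹) ∧
  (∀ A B : G, A * B * A⁻¹ * B⁻¹ = z → {g : G | g * A * g⁻¹ = A ∧ g * B * g⁻¹ = B}.Finite)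

/-- **T1 · ANCHOR — the e-flux-projected twisted femto slab is pure, uniformly in the coupling and in the long extents** (stub
`stub_anchor` of the line `twisted-slab-continuity`, census row 43; OPEN).  For simply-connected compact simple `G`, a central `z ≠ 1`
of finite order carrying an ISOLATING twist, and every lattice representation `r`: there are a transverse size `ℓ₀ ≥ 2`, a threshold
`β₀` and constants `c > 0`, `C` with `projSlabDefect r.ρ β z n ℓ₀ L t ≤ C · L · e^{−c t}` for ALL `β ≥ β₀`, `L ≥ 2`, `t ≥ 1` — the
lattice gap `c ≍ 1/(Nℓ₀)` of the twist-eating slab is tree-level, hence `β`-uniform; the factor `L` is the one-dimensional multiplicity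
of its excitations.  No floor, no unit map.  VERBATIM the crux workfile's `TwistedSlabContinuity.TwistedSlabAnchor` (definitionally
equal).  HYPOTHESIS-side `Prop` — an OPEN obligation of the line, NOT a published fact and NOT proved anywhere in the tree: its β- and
L-UNIFORMITY is a weak-coupling cluster expansion not in print; the one-box version with box-dependent constants is
`TwistedSlab.projSlabDefect_le_exp_oneBox` (`BalabanLadderIRTwistedSlabOneBox`). -/
def TwistedSlabAnchor : Prop :=
  ∀ (G : Type) [Group G] [TopologicalSpace G] [IsTopologicalGroup G] [CompactSpace G],
    IsCompactSimpleLieGroup G → SimplyConnectedSpace G →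
    letI : MeasurableSpace G := borel G
    haveI : BorelSpace G := ⟨rfl⟩
    ∀ (z : G) (n : ℕ), z ∈ Subgroup.center G → z ≠ 1 → 0 < n → z ^ n = 1 → HasIsolatingTwist G z →
      ∀ r : LatticeRep G, ∃ (ℓ₀ : ℕ) (β₀ c C : ℝ), 2 ≤ ℓ₀ ∧ 0 < c ∧
        ∀ β : ℝ, β₀ ≤ β → ∀ L t : ℕ, 2 ≤ L → 1 ≤ t →
          projSlabDefect r.ρ β z n ℓ₀ L t ≤ C * (L : ℝ) * Real.exp (-(c * (t : ℝ)))

end Summit.QuantumFields.YangMills.Cruxes.IRcof.TwistedSlab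

end
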